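import Mathlib.MeasureTheory.Integral.IntegralEqImproper
import Mathlib.Analysis.SpecialFunctions.ImproperIntegrals
import Mathlib.MeasureTheory.Function.Floor
import Mathlib.Data.Int.Interval
import Mathlib.Analysis.Distribution.SchwartzSpace.Deriv
import Literature.NumberTheory.LFunctions.WeilExplicit
import HarnessLib

/-!
# Summation over the first crossings (`stub_crossingSum`)

Route `SpectralTrace`, crux `WindowStep` (stmt-RiemannHypothesis-14659), line `floor-feedback`,
stub `stub_crossingSum` (K2b; pure real analysis, Mathlib only).

**Statement.** Let `G : ℝ → ℝ` be continuous with monotone integer part `⌊G⌋`, `G → +∞` at `+∞`,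
`G → -∞` at `-∞`, `|G(T)| ≤ L(1+T²)`, and let `F : ℝ → ℂ` be differentiable with continuous
derivative `F'`, `‖F‖, ‖F'‖ ≤ C/(1+T²)²`. With the first crossings
`γ_j = sInf {T | j ≤ G T}` (`j ∈ ℤ`),
`HasSum (j ↦ F(γ_j)) (−∫ F'(T) ⌊G(T)⌋ dT)`.

**Proof (layer cake).** The level set `{T | j ≤ G T}` is nonempty, bounded below and closed, so
`γ_j` belongs to it and `G(γ_j) = j` (continuity from the left); monotonicity of `⌊G⌋` gives the
key equivalence `j ≤ ⌊G T⌋ ↔ γ_j ≤ T`. By the fundamental theorem of calculus on half-lines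
(`F → 0` at `±∞` since `F, F'` are integrable), `F(γ_j) = ∫ 𝟙[T < γ_j] F'(T) dT` (used for
`j ≤ 0`) and `F(γ_j) = −∫ 𝟙[γ_j ≤ T] F'(T) dT` (used for `j ≥ 1`). For fixed `T` with
`n = ⌊G T⌋` the integrands sum over `j` (a finite sum) to
`F'(T) (#{j : n < j ≤ 0} − #{j : 0 < j ≤ n}) = −n F'(T)`, and they are dominated by
`‖F'(T)‖ (𝟙[n < j ≤ 0] + 𝟙[0 < j ≤ n])`, whose sum `‖F'(T)‖ |n| ≤ C(L+1)/(1+T²)` is integrable;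
the dominated convergence theorem for series
(`MeasureTheory.hasSum_integral_of_dominated_convergence`) gives the claim. [folklore]
-/

set_option linter.dupNamespace false

noncomputable section

open Complex Filter Set MeasureTheory
open scoped Real Topology BigOperators FourierTransform SchwartzMap

namespace Summit.RiemannHypothesis.RiemannHypothesis.Theorems.SpectralTraceWindowStep

open Literature.NumberTheory.LFunctions

/-! ## Counting identities over `ℤ` -/

/-- For `n ∈ ℤ`: `Σ_j (𝟙[n < j ≤ 0] − 𝟙[0 < j ≤ n]) = −n` (a finite sum). [folklore] -/
theorem stub_crossingSum_combSum (n : ℤ) :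
    HasSum (fun j : ℤ => ((if n < j ∧ j ≤ 0 then (1 : ℂ) else 0) -
      (if 0 < j ∧ j ≤ n then (1 : ℂ) else 0))) (-(n : ℂ)) := by
  have hsupp : ∀ j ∉ Finset.Ioc (min n 0) (max n 0),
      ((if n < j ∧ j ≤ 0 then (1 : ℂ) else 0) - (if 0 < j ∧ j ≤ n then (1 : ℂ) else 0)) = 0 := by
    intro j hj
    rw [Finset.mem_Ioc] at hj
    rw [if_neg (by omega), if_neg (by omega), sub_zero]
  convert hasSum_sum_of_ne_finset_zero (L := .unconditional ℤ) hsupp using 1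
  rw [Finset.sum_sub_distrib, Finset.sum_boole, Finset.sum_boole]
  have h1 : (Finset.Ioc (min n 0) (max n 0)).filter (fun j => n < j ∧ j ≤ 0) = Finset.Ioc n 0 := by
    ext j; simp only [Finset.mem_filter, Finset.mem_Ioc]; omega
  have h2 : (Finset.Ioc (min n 0) (max n 0)).filter (fun j => 0 < j ∧ j ≤ n) = Finset.Ioc 0 n := by
    ext j; simp only [Finset.mem_filter, Finset.mem_Ioc]; omega
  rw [h1, h2, Int.card_Ioc, Int.card_Ioc]
  have h : ((0 - n).toNat : ℤ) - ((n - 0).toNat : ℤ) = -n := by omega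
  have h' := congrArg (fun z : ℤ => (z : ℂ)) h
  push_cast at h'
  exact h'.symm

/-- For `n ∈ ℤ`: `Σ_j (𝟙[n < j ≤ 0] + 𝟙[0 < j ≤ n]) = |n|` (a finite sum). [folklore] -/
theorem stub_crossingSum_combNorm (n : ℤ) :
    HasSum (fun j : ℤ => ((if n < j ∧ j ≤ 0 then (1 : ℝ) else 0) +
      (if 0 < j ∧ j ≤ n then (1 : ℝ) else 0))) |(n : ℝ)| := by
  have hsupp : ∀ j ∉ Finset.Ioc (min n 0) (max n 0),
      ((if n < j ∧ j ≤ 0 then (1 : ℝ) else 0) + (if 0 < j ∧ j ≤ n then (1 : ℝ) else 0)) = 0 := by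
    intro j hj
    rw [Finset.mem_Ioc] at hj
    rw [if_neg (by omega), if_neg (by omega), add_zero]
  convert hasSum_sum_of_ne_finset_zero (L := .unconditional ℤ) hsupp using 1
  rw [Finset.sum_add_distrib, Finset.sum_boole, Finset.sum_boole]
  have h1 : (Finset.Ioc (min n 0) (max n 0)).filter (fun j => n < j ∧ j ≤ 0) = Finset.Ioc n 0 := by
    ext j; simp only [Finset.mem_filter, Finset.mem_Ioc]; omega
  have h2 : (Finset.Ioc (min n 0) (max n 0)).filter (fun j => 0 < j ∧ j ≤ n) = Finset.Ioc 0 n := by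
    ext j; simp only [Finset.mem_filter, Finset.mem_Ioc]; omega
  rw [h1, h2, Int.card_Ioc, Int.card_Ioc]
  have h : ((0 - n).toNat : ℤ) + ((n - 0).toNat : ℤ) = |n| := by
    rcases le_total 0 n with hn | hn
    · rw [abs_of_nonneg hn]; omega
    · rw [abs_of_nonpos hn]; omega
  have h' := congrArg (fun z : ℤ => (z : ℝ)) h
  push_cast at h'
  exact h'.symm

/-! ## The first crossings `γ_c = sInf {T | c ≤ G T}` -/

/-- The level set `{T | c ≤ G T}` is bounded below when `G → -∞` at `-∞`. [folklore] -/
theorem stub_crossingSum_bddBelow {G : ℝ → ℝ} (hbot : Tendsto G atBot atBot) (c : ℝ) :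
    BddBelow {T : ℝ | c ≤ G T} := by
  obtain ⟨B, hB⟩ := eventually_atBot.mp (hbot.eventually_lt_atBot c)
  exact ⟨B, fun T hT => le_of_not_gt fun h => (hB T h.le).not_ge hT⟩

/-- The level set `{T | c ≤ G T}` is nonempty when `G → +∞` at `+∞`. [folklore] -/
theorem stub_crossingSum_nonempty {G : ℝ → ℝ} (htop : Tendsto G atTop atTop) (c : ℝ) :
    {T : ℝ | c ≤ G T}.Nonempty :=
  (htop.eventually_ge_atTop c).exists

/-- The first crossing of the level `c` is a crossing: `G (sInf {T | c ≤ G T}) = c`. [folklore] -/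
theorem stub_crossingSum_level {G : ℝ → ℝ} (hG : Continuous G) (htop : Tendsto G atTop atTop)
    (hbot : Tendsto G atBot atBot) (c : ℝ) : G (sInf {T : ℝ | c ≤ G T}) = c := by
  have hbdd := stub_crossingSum_bddBelow hbot c
  have hmem : sInf {T : ℝ | c ≤ G T} ∈ {T : ℝ | c ≤ G T} :=
    (isClosed_le continuous_const hG).csInf_mem (stub_crossingSum_nonempty htop c) hbdd
  refine le_antisymm ?_ hmem
  have hlt : ∀ T ∈ Iio (sInf {T : ℝ | c ≤ G T}), G T ≤ c := fun T hT =>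
    (not_le.mp fun h => notMem_of_lt_csInf hT hbdd h).le
  have ht : Tendsto G (𝓝[<] sInf {T : ℝ | c ≤ G T}) (𝓝 (G (sInf {T : ℝ | c ≤ G T}))) :=
    hG.continuousAt.continuousWithinAt.tendsto
  exact le_of_tendsto ht (eventually_nhdsWithin_of_forall hlt)

/-- The key equivalence: for `⌊G⌋` monotone, `j ≤ ⌊G T⌋ ↔ γ_j ≤ T`. [folklore] -/
theorem stub_crossingSum_iff {G : ℝ → ℝ} (hG : Continuous G) (hmono : Monotone fun T : ℝ => ⌊G T⌋)
    (htop : Tendsto G atTop atTop) (hbot : Tendsto G atBot atBot) (j : ℤ) (T : ℝ) :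
    j ≤ ⌊G T⌋ ↔ sInf {T : ℝ | (j : ℝ) ≤ G T} ≤ T := by
  constructor
  · intro h
    exact csInf_le (stub_crossingSum_bddBelow hbot _) (Int.le_floor.mp h)
  · intro h
    have h1 : ⌊G (sInf {T : ℝ | (j : ℝ) ≤ G T})⌋ ≤ ⌊G T⌋ := hmono h
    rwa [stub_crossingSum_level hG htop hbot, Int.floor_intCast] at h1

/-! ## Decay, integrability and the fundamental theorem of calculus on half-lines -/

/-- A continuous function with `‖g T‖ ≤ C/(1+T²)²` is integrable. [folklore] -/
theorem stub_crossingSum_integrable {g : ℝ → ℂ} {C : ℝ} (hg : Continuous g)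
    (hb : ∀ T : ℝ, ‖g T‖ ≤ C / (1 + T ^ 2) ^ 2) : Integrable g := by
  have hC : 0 ≤ C := by
    have h := (norm_nonneg _).trans (hb 0)
    simpa using h
  refine (integrable_inv_one_add_sq.const_mul C).mono' hg.aestronglyMeasurable
    (Eventually.of_forall fun T => ?_)
  calc ‖g T‖ ≤ C / (1 + T ^ 2) ^ 2 := hb T
    _ ≤ C / (1 + T ^ 2) := by
        apply div_le_div_of_nonneg_left hC (by positivity)
        exact le_self_pow₀ (by nlinarith [sq_nonneg T]) two_ne_zero
    _ = C * (1 + T ^ 2)⁻¹ := div_eq_mul_inv _ _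

/-- The dominating function `‖F'(T)‖ |⌊G T⌋| ≤ C(L+1)/(1+T²)` is integrable. [folklore] -/
theorem stub_crossingSum_dominated {G : ℝ → ℝ} {F' : ℝ → ℂ} {C L : ℝ} (hG : Continuous G)
    (hGL : ∀ T : ℝ, |G T| ≤ L * (1 + T ^ 2)) (hF'c : Continuous F')
    (hF' : ∀ T : ℝ, ‖F' T‖ ≤ C / (1 + T ^ 2) ^ 2) :
    Integrable fun T : ℝ => ‖F' T‖ * |((⌊G T⌋ : ℤ) : ℝ)| := by
  have hC : 0 ≤ C := by
    have h := (norm_nonneg _).trans (hF' 0)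
    simpa using h
  have hmeas : AEStronglyMeasurable (fun T : ℝ => ‖F' T‖ * |((⌊G T⌋ : ℤ) : ℝ)|) volume := by
    apply hF'c.norm.aestronglyMeasurable.mul
    have hfl : Measurable fun T : ℝ => ⌊G T⌋ := Int.measurable_floor.comp hG.measurable
    exact ((measurable_of_countable fun z : ℤ => |(z : ℝ)|).comp hfl).aestronglyMeasurable
  refine (integrable_inv_one_add_sq.const_mul (C * (L + 1))).mono' hmeas
    (Eventually.of_forall fun T => ?_)
  have h1 : (0 : ℝ) < 1 + T ^ 2 := by positivity
  have hfl : |((⌊G T⌋ : ℤ) : ℝ)| ≤ (L + 1) * (1 + T ^ 2) := by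
    have a1 := Int.floor_le (G T)
    have a2 := Int.sub_one_lt_floor (G T)
    have a3 := abs_le.mp (hGL T)
    rw [abs_le]
    constructor <;> nlinarith [sq_nonneg T]
  rw [Real.norm_of_nonneg (by positivity)]
  calc ‖F' T‖ * |((⌊G T⌋ : ℤ) : ℝ)| ≤ C / (1 + T ^ 2) ^ 2 * ((L + 1) * (1 + T ^ 2)) :=
        mul_le_mul (hF' T) hfl (abs_nonneg _) (by positivity)
    _ = C * (L + 1) * (1 + T ^ 2)⁻¹ := by
        field_simp

/-- FTC on `[a, ∞)`: `∫ 𝟙[a ≤ T] F'(T) dT = −F(a)` when `F → 0` at `+∞`. [folklore] -/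
theorem stub_crossingSum_integral_Ici {F F' : ℝ → ℂ} (hderiv : ∀ T : ℝ, HasDerivAt F (F' T) T)
    (hF'int : Integrable F') (htop0 : Tendsto F atTop (𝓝 0)) (a : ℝ) :
    ∫ T : ℝ, (Ici a).indicator F' T = -F a := by
  rw [integral_indicator measurableSet_Ici, integral_Ici_eq_integral_Ioi,
    integral_Ioi_of_hasDerivAt_of_tendsto' (fun x _ => hderiv x) hF'int.integrableOn htop0,
    zero_sub]

/-- FTC on `(−∞, a)`: `∫ 𝟙[T < a] F'(T) dT = F(a)` when `F → 0` at `−∞`. [folklore] -/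
theorem stub_crossingSum_integral_Iio {F F' : ℝ → ℂ} (hderiv : ∀ T : ℝ, HasDerivAt F (F' T) T)
    (hF'int : Integrable F') (hbot0 : Tendsto F atBot (𝓝 0)) (a : ℝ) :
    ∫ T : ℝ, (Iio a).indicator F' T = F a := by
  rw [integral_indicator measurableSet_Iio, ← integral_Iic_eq_integral_Iio,
    integral_Iic_of_hasDerivAt_of_tendsto' (fun x _ => hderiv x) hF'int.integrableOn hbot0,
    sub_zero]

/-! ## The summation formula -/

/-- **K2b · summation over the first crossings.** For `G` continuous with monotone integer part,
`G → ±∞` at `±∞`, `|G| ≤ L(1+T²)`, and `F` differentiable with continuous derivative `F'`,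
`‖F‖, ‖F'‖ ≤ C/(1+T²)²`: with `γ_j = sInf {T | j ≤ G T}`,
`HasSum (j ↦ F(γ_j)) (−∫ F'(T) ⌊G T⌋ dT)`. [folklore] -/
theorem stub_crossingSum :
    ∀ (G : ℝ → ℝ) (F F' : ℝ → ℂ) (C L : ℝ), Continuous G → Monotone (fun T : ℝ => ⌊G T⌋) →
      Tendsto G atTop atTop → Tendsto G atBot atBot → (∀ T : ℝ, |G T| ≤ L * (1 + T ^ 2)) →
      (∀ T : ℝ, HasDerivAt F (F' T) T) → Continuous F' →
      (∀ T : ℝ, ‖F T‖ ≤ C / (1 + T ^ 2) ^ 2) → (∀ T : ℝ, ‖F' T‖ ≤ C / (1 + T ^ 2) ^ 2) →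
      HasSum (fun j : ℤ => F (sInf {T : ℝ | (j : ℝ) ≤ G T})) (-∫ T : ℝ, F' T * ((⌊G T⌋ : ℝ) : ℂ)) := by
  intro G F F' C L hG hmono htop hbot hGL hderiv hF'c hF hF'
  -- integrability and limits of `F`
  have hFint : Integrable F :=
    stub_crossingSum_integrable (continuous_iff_continuousAt.mpr fun T => (hderiv T).continuousAt)
      hF
  have hF'int : Integrable F' := stub_crossingSum_integrable hF'c hF'
  have htop0 : Tendsto F atTop (𝓝 0) :=
    tendsto_zero_of_hasDerivAt_of_integrableOn_Ioi (a := 0) (fun x _ => hderiv x)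
      hF'int.integrableOn hFint.integrableOn
  have hbot0 : Tendsto F atBot (𝓝 0) :=
    tendsto_zero_of_hasDerivAt_of_integrableOn_Iic (a := 0) (fun x _ => hderiv x)
      hF'int.integrableOn hFint.integrableOn
  -- the crossings and the layers
  set γ : ℤ → ℝ := fun j => sInf {T : ℝ | (j : ℝ) ≤ G T}
  have key : ∀ (j : ℤ) (T : ℝ), j ≤ ⌊G T⌋ ↔ γ j ≤ T := fun j T =>
    stub_crossingSum_iff hG hmono htop hbot j T
  set Φ : ℤ → ℝ → ℂ := fun j T =>
    if j ≤ 0 then (Iio (γ j)).indicator F' T else -(Ici (γ j)).indicator F' T with hΦ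
  have hpt : ∀ (j : ℤ) (T : ℝ), Φ j T = F' T * ((if ⌊G T⌋ < j ∧ j ≤ 0 then (1 : ℂ) else 0) -
      (if 0 < j ∧ j ≤ ⌊G T⌋ then (1 : ℂ) else 0)) := by
    intro j T
    have e1 : T < γ j ↔ ⌊G T⌋ < j := by rw [← not_le, ← key, not_le]
    have e2 : γ j ≤ T ↔ j ≤ ⌊G T⌋ := (key j T).symm
    simp only [hΦ, Set.indicator_apply, mem_Iio, mem_Ici, e1, e2]
    by_cases hj : j ≤ 0
    · have hj' : ¬ 0 < j := not_lt.mpr hj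
      simp only [hj, hj', if_true, and_true, false_and, if_false, sub_zero]
      split_ifs <;> simp
    · have hj' : 0 < j := not_le.mp hj
      simp only [hj, hj', if_false, and_false, true_and, zero_sub]
      split_ifs <;> simp
  have hint : ∀ j : ℤ, ∫ T : ℝ, Φ j T = F (γ j) := by
    intro j
    by_cases hj : j ≤ 0
    · simp only [hΦ, hj, if_true]
      exact stub_crossingSum_integral_Iio hderiv hF'int hbot0 (γ j)
    · simp only [hΦ, hj, if_false]
      rw [integral_neg, stub_crossingSum_integral_Ici hderiv hF'int htop0 (γ j), neg_neg]
  have hmeas : ∀ j : ℤ, AEStronglyMeasurable (Φ j) volume := by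
    intro j
    by_cases hj : j ≤ 0
    · simp only [hΦ, hj, if_true]
      exact hF'c.aestronglyMeasurable.indicator measurableSet_Iio
    · simp only [hΦ, hj, if_false]
      exact (hF'c.aestronglyMeasurable.indicator measurableSet_Ici).neg
  -- dominated convergence for series
  have hmain : HasSum (fun j : ℤ => ∫ T : ℝ, Φ j T) (∫ T : ℝ, -(F' T * ((⌊G T⌋ : ℝ) : ℂ))) := by
    refine hasSum_integral_of_dominated_convergence
      (fun j T => ‖F' T‖ * ((if ⌊G T⌋ < j ∧ j ≤ 0 then (1 : ℝ) else 0) +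
        (if 0 < j ∧ j ≤ ⌊G T⌋ then (1 : ℝ) else 0))) hmeas ?_ ?_ ?_ ?_
    · intro j
      refine Eventually.of_forall fun T => ?_
      rw [hpt, norm_mul]
      refine mul_le_mul_of_nonneg_left ((norm_sub_le _ _).trans (add_le_add ?_ ?_)) (norm_nonneg _)
        <;> split_ifs <;> simp
    · exact Eventually.of_forall fun T =>
        ((stub_crossingSum_combNorm ⌊G T⌋).mul_left ‖F' T‖).summable
    · have e : (fun T : ℝ => ∑' j : ℤ, ‖F' T‖ * ((if ⌊G T⌋ < j ∧ j ≤ 0 then (1 : ℝ) else 0) +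
          (if 0 < j ∧ j ≤ ⌊G T⌋ then (1 : ℝ) else 0))) =
          fun T : ℝ => ‖F' T‖ * |((⌊G T⌋ : ℤ) : ℝ)| :=
        funext fun T => ((stub_crossingSum_combNorm ⌊G T⌋).mul_left ‖F' T‖).tsum_eq
      rw [e]
      exact stub_crossingSum_dominated hG hGL hF'c hF'
    · refine Eventually.of_forall fun T => ?_
      have e : (fun j : ℤ => Φ j T) = fun j : ℤ =>
          F' T * ((if ⌊G T⌋ < j ∧ j ≤ 0 then (1 : ℂ) else 0) -
            (if 0 < j ∧ j ≤ ⌊G T⌋ then (1 : ℂ) else 0)) := funext fun j => hpt j T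
      rw [e]
      have hv : F' T * -((⌊G T⌋ : ℤ) : ℂ) = -(F' T * ((⌊G T⌋ : ℝ) : ℂ)) := by
        rw [mul_neg, Complex.ofReal_intCast]
      rw [← hv]
      exact (stub_crossingSum_combSum ⌊G T⌋).mul_left (F' T)
  have e : (fun j : ℤ => ∫ T : ℝ, Φ j T) = fun j : ℤ => F (γ j) := funext hint
  rw [e, integral_neg] at hmain
  exact hmain

end Summit.RiemannHypothesis.RiemannHypothesis.Theorems.SpectralTraceWindowStep

end
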